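import Summits.QuantumFields.BalabanUV.T4Continuum.Support.NE7FlatLiftBookkeeping
import Summits.QuantumFields.BalabanUV.T4Continuum.Support.NE7FlatHkCurlLetter
import Summits.QuantumFields.BalabanUV.T4Continuum.Support.NE7FlatHkOrthogonal
import Summits.QuantumFields.BalabanUV.T4Continuum.Support.NE7ExpansionRemainderFlat
import Summits.QuantumFields.BalabanUV.T4Continuum.Support.NE7TangentTransportRightInv
import Summits.QuantumFields.BalabanUV.T4Continuum.Support.NE7CoarseCurvatureLetter
import Summits.QuantumFields.BalabanUV.T4Continuum.Support.NE3CpushGaugeCovariance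
import Summits.QuantumFields.BalabanUV.T4Continuum.Support.NE3SmoothLiftCurl
import Summits.QuantumFields.BalabanUV.T4Continuum.Support.NE7TanCriticalGauge
import Summits.QuantumFields.BalabanUV.T4Continuum.Support.NE7ConvOneStepWeightedUnique
import Summits.QuantumFields.BalabanUV.T4Continuum.Support.BlockAverageCurrent
import HarnessLib

/-!
# NE7ApeTrivialFlatEnd — THE (APE) BOOTSTRAP AT THE TRIVIAL FLAT DATUM, COMPOSED: every letter of F44's pointwise bootstrap a TREE THEOREM except the
# two DISPLAYED Bałaban types — REP♭'s top normalisation (a hypothesis on the representative) and G♭ (the slice solver letter, (1.115) 2nd entry TYPE)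

Cell `pub-balaban`, rung (B)+1 sub-cell t4, lineage `b2b-balaban-t4-ne7-p1`, generation 71 (CRUX PROVER NE7 #1); memos H14 (gen 70) and
`t4/b2b-balaban-t4-ne7-p1-g71/HUNT-H15-EXP-LANDED-TT-CURRENCY.md` §3, §7.  File F54 — the END of the trivial-datum programme of F36–F53, in dimension `d + 1`
(where F37 is stated): F44 `NE7FlatLiftBookkeeping.smallField_vary_of_flatLetters'` with
  `A_N := R_H B` — the flat Landau lift of the coarse datum `φ = D_1 A` (F36∕F37 `NE7FlatHkCurlLetter.rightInverse_flat_curl_le`: EXACT + the curl letter `c_N`;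
  F40b `NE7FlatHkOrthogonal.hess_flat_hkLift_eq_zero`: NORTH; F44 `hkLift_periodic`), the curl of `φ` by F43 `NE7CoarseCurvatureLetter.coarseCurl_le` (`β′ = 0` by the
  top normalisation), `hEXP :=` F48b `NE7ExpansionRemainderFlat.abs_dAction_vary_sub_hess_flat_le`, `hTT :=` F53 `NE7TangentTransportRightInv.hTT_gauge_of_towerLetter` with
  the straight-tower letter `Λ` DISPLAYED as a hypothesis (F51 `NE7QbarLipschitzBudget` discharges it, `Λ = 2C_Sα̂M^{−d}`; the fully explicit composition is the
  sequel `NE7ApeTrivialFlatEndBudget`), the slice `S :=` the periodic tangent space at `1`.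
WHY.  (APE) — the a-priori plaquette estimate of the tangent-critical admissible configuration — is the one hypothesis of F29∕F31's ONE-STEP that is not a tree
theorem; B11 Sect. F's bootstrap (memo H14) reduces it, at the trivial flat datum, to letters; F36–F53 proved the letters; THIS FILE composes them, so that
(APE) at the trivial datum is now EXACTLY: REP♭ (B8 Thm 2 TYPE: the small gauge representative `Ũ = e^{A}` with sup∕gradient currencies AND flat top average)
+ G♭ ((1.115) 2nd entry TYPE: the sup-curl of a periodic tangent field at `1` is `K_G` times the `ℓ¹`-dual norm of its Hessian source) ⟹ `SmallField Ũ (…)`.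
WHAT ([folklore]; 0 def, 0 sorry).  **`smallField_vary_flat_of_trivialLetters`**: for `L ≥ 2`, `N ≥ 1`, `k`, a skew `(L^{k+1}N)`-periodic `A` with `‖A‖ ≤ α₀`,
lattice differences `≤ α₁`, the representative `Ũ = vary 1 A 1` of class radius `x` (W5∕W6 regime) and plaquette radius `a`, the smallness lines of the sup
currency `α̂ = L^{k+1}α₀` (row NE3's σ-line), the TOP NORMALISATION `cavgIter L (k+1) Ũ = 1`, the tower letter `Λ ≥ 0`, tangent-criticality of `Ũ`, and G♭
with constant `K_G`:  `SmallField Ũ (K_G·(τ + ρ) + c_N + 28α₀²)` with `τ = a·(curl1C∕(1−θℓ))·M^{d−1}·Λ`, and `ρ, c_N` the EXPLICIT expressions of F48b, F37×F43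
(their `M`-currencies: F48b `rho_currency` (`ρ ≲ M⁻³`), memo H15 §7 (`τ ∼ δα̂M⁻³` once `Λ = 2C_Sα̂M^{−d}`, `tau_currency_delta`), F37 (`c_N ∼ ĝ∕M²`)).
**`smallField_of_trivialLetters_gauge`**: the same pulled back through the gauge to the admissible configuration `U` itself (`U^u = e^{A}`, `u` unitary
periodic; criticality transported by F39 `NE7TanCriticalGauge.tanCritical_gaugeAct`, radii by `smallField_gaugeAct` ∕ F26 `smallField_of_gaugeAct_eq`).
`tau_currency`, `tau_currency_delta`: with F51's `Λ`, the transport density equals `2·a·C·C_S·α̂∕M = 2·C·C_S·δ·α̂∕M³` (`a = δM⁻²`) — the H14 currency, in kernel.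
HONEST FRAMING (page 1): a composition of tree theorems; REP♭ (incl. the top normalisation), G♭ and (here) the tower letter `Λ` are HYPOTHESES; ONE datum (the
trivial one), not F31's `hape` on the data class; (APE) NOT proved unconditionally; NOT ONE-STEP, NOT NE7; spine 0∕9; finite T⁴ rung (B)+1 — NOT infinite volume,
NOT mass gap, NOT Clay.  Continuum YM on T⁴ ⇐ BetaPertH ∧ nine spine estimates (0/9 proved); BetaPertH ⇐ (D1) ∧ (D4) ∧ CAP+tail; G-an2-4 gates asym, D1 and NE2/3/4.
-/

set_option autoImplicit false

open scoped BigOperators Matrix.Norms.L2Operator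
open NormedSpace Finset

namespace Summit.QuantumFields.BalabanUV.T4Continuum.NE7ApeTrivialFlatEnd

open Literature.MathematicalPhysics.QuantumFieldTheory.Balaban1983to89
open B7Prop1Explicit B7Prop2Explicit MatrixLog UnitaryModel
open T4AveragingDeficitWall (IsUnitaryCfg IsSkewDir SmallField vary curlAt dirL1 flat_mem_classes)
open T4AveragingDeficitWallBoundary (IsPeriodicCfg periodBox)
open AveragingDeficitPeriodicCounting (IsPeriodicDir)
open AveragingDeficitPlaqDeriv (vary_isUnitaryCfg)
open AveragingDeficitMultiLevelPrep (cavgIter LevelSmall tower)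
open AveragingDeficitMultiLevelBridge (tower_eq)
open MinimalActionLevels (perWin)
open BlockAveragePushDirSplit (flat)
open BlockAverageVaryDisc (rho0)
open B4Sect5Proof (latticeConst)
open B5Prop11Plancherel (Tor fine)
open B5Hk163Strip (kappa163)
open B5Hk163Torus (HkOp)
open B5Hk163TorusHolderDecay (CdecD)
open B6LowerBound2153Torus (toT)
open SmoothRefineInterp (interp)
open NE3TangentNoGoWords (dPot)
open NE3TangentFlatStructure (framePot)
open NE3HessForm (hess dAction)
open NE3TangentCovariantTower (dirIter QbarIter cavgIter_flat)
open NE3ResidualSliceRep (dirIter_sub)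
open NE3QbarIterCovLiftPrep (cruxC)
open NE3RightInverseSolveLetters (thetaLoc)
open NE3HatInvCurlLetters (curl1C curl1C_nonneg)
open NE3QuadRemainderTower (vary_add_period)
open NE3SmoothLiftCurl (curlAt_flat_eq)
open NE3CpushGaugeCovariance (dirIter_succ_eq_cpushIter)
open NE7FlatLiftBookkeeping (hkLift_periodic smallField_vary_of_flatLetters')
open NE7FlatHkCurlLetter (rightInverse_flat_curl_le)
open NE7FlatHkOrthogonal (hess_flat_hkLift_eq_zero)
open NE7ExpansionRemainderFlat (abs_dAction_vary_sub_hess_flat_le)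
open NE7TangentTransportRightInv (hTT_gauge_of_towerLetter)
open NE7TangentTransportGauge (dirIter_skew_periodic)
open NE7CoarseCurvatureLetter (coarseCurl_le levelSmall_zero)
open NE3EnergyShapes (IsUnitarySite)
open BlockAverageCurrent (smallField_gaugeAct)
open NE7ConvOneStepWeightedUnique (smallField_of_gaugeAct_eq)
open NE7TanCriticalGauge (tanCritical_gaugeAct)

noncomputable section

variable {d : ℕ} {n : Type*} [Fintype n] [DecidableEq n]

/-- **THE (APE) BOOTSTRAP AT THE TRIVIAL FLAT DATUM, COMPOSED** (dimension `d + 1`).  Hypotheses, in order: the representative's exponent `A` (skew,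
`(L^{k+1}·N)`-periodic, `‖A‖ ≤ α₀`, lattice differences `≤ α₁`); the class data of `Ũ = vary 1 A 1` (radius `x ≥ 0` with `LevelSmall (d+1) L k x` in the W5∕W6
regime, plaquette radius `a ≥ 0`); the σ-line of `α̂ = L^{k+1}α₀`; REP♭'s TOP NORMALISATION `cavgIter L (k+1) Ũ = 1`; the straight-tower letter `Λ`;
tangent-criticality of `Ũ`; G♭ with constant `K_G` on the periodic tangent space at `1`.  Conclusion: `SmallField Ũ (K_G·(τ + ρ) + c_N + 28α₀²)` with
`τ = a·(curl1C∕(1−θℓ))·M^{d−1}·Λ` (F53), the explicit `ρ` (F48b) and `c_N` (F37 at `g :=` F43's coarse curl bound). [folklore] -/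
theorem smallField_vary_flat_of_trivialLetters [Nonempty n] {L N : ℕ} [NeZero N] (hL : 2 ≤ L) (k : ℕ)
    {A : Site (d + 1) → Fin (d + 1) → Matrix n n ℂ} (hA : IsSkewDir A) (hAP : IsPeriodicDir A ((L ^ (k + 1) * N : ℕ) : ℤ))
    {α₀ α₁ : ℝ} (hα₀ : 0 ≤ α₀) (hα₁ : 0 ≤ α₁) (hAα : ∀ (y : Site (d + 1)) (κ : Fin (d + 1)), ‖A y κ‖ ≤ α₀)
    (hA1 : ∀ (y : Site (d + 1)) (κ τ : Fin (d + 1)), ‖A (y + e τ) κ - A y κ‖ ≤ α₁)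
    {x a : ℝ} (hx : 0 ≤ x) (hs : LevelSmall (d + 1) L k x) (hUx : SmallField (vary (flat (d := d + 1) (n := n)) A 1) x) (ha : 0 ≤ a)
    (hUa : SmallField (vary (flat (d := d + 1) (n := n)) A 1) a)
    (hθ : cruxC (d + 1) L * (((L : ℝ) ^ (k + 1)) ^ 2 * x) < 1) (hθl : thetaLoc (d + 1) L * (((L : ℝ) ^ (k + 1)) ^ 2 * x) < 1)
    (hε : ((L : ℝ) ^ (k + 1)) ^ 2 * x ≤ 1)
    (hσ : 4 * (3 + 12 * ((d + 1 : ℕ) : ℝ)) ^ 2 * (L : ℝ) ^ (k + 1) * α₀ ≤ rho0 (d + 1) L ^ 2)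
    (hflatTop : cavgIter L (k + 1) (vary (flat (d := d + 1) (n := n)) A 1) = flat)
    {Λ : ℝ} (hΛ0 : 0 ≤ Λ)
    (hΛ : ∀ Y : Site (d + 1) → Fin (d + 1) → Matrix n n ℂ, IsSkewDir Y → IsPeriodicDir Y ((L ^ (k + 1) * N : ℕ) : ℤ) →
      ∑ z ∈ periodBox N, ∑ κ : Fin (d + 1), ‖QbarIter L (k + 1) (vary (flat (d := d + 1) (n := n)) A 1) Y z κ
          - QbarIter L (k + 1) (flat (d := d + 1) (n := n)) Y z κ‖ ≤ Λ * dirL1 Y (periodBox (d := d + 1) (L ^ (k + 1) * N)))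
    (hcrit : ∀ Y' : Site (d + 1) → Fin (d + 1) → Matrix n n ℂ, IsSkewDir Y' → IsPeriodicDir Y' ((L ^ (k + 1) * N : ℕ) : ℤ) →
      dirIter L (k + 1) (vary (flat (d := d + 1) (n := n)) A 1) Y' = 0 →
      dAction (vary (flat (d := d + 1) (n := n)) A 1) Y' (perWin (d + 1) (L ^ (k + 1) * N)) = 0)
    {KG : ℝ}
    (hG : ∀ X : Site (d + 1) → Fin (d + 1) → Matrix n n ℂ, IsPeriodicDir X ((L ^ (k + 1) * N : ℕ) : ℤ) →
      dirIter L (k + 1) (flat (d := d + 1) (n := n)) X = 0 → ∀ g : ℝ, 0 ≤ g →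
      (∀ Y : Site (d + 1) → Fin (d + 1) → Matrix n n ℂ, IsSkewDir Y → IsPeriodicDir Y ((L ^ (k + 1) * N : ℕ) : ℤ) →
        dirIter L (k + 1) (flat (d := d + 1) (n := n)) Y = 0 →
        |hess (flat (d := d + 1) (n := n)) X Y (perWin (d + 1) (L ^ (k + 1) * N))| ≤ g * dirL1 Y (periodBox (d := d + 1) (L ^ (k + 1) * N))) →
      ∀ (z : Site (d + 1)) (μ ν : Fin (d + 1)), μ ≠ ν → ‖curlAt (flat (d := d + 1) (n := n)) X z μ ν‖ ≤ KG * g) :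
    SmallField (vary (flat (d := d + 1) (n := n)) A 1)
      (KG * (((a * ((curl1C (d + 1) L / (1 - thetaLoc (d + 1) L * (((L : ℝ) ^ (k + 1)) ^ 2 * x)))
                  * (((L : ℝ) ^ (k + 1)) ^ (d + 1) / ((L : ℝ) ^ (k + 1)) ^ 2)))
              * Λ)
            + (Fintype.card (T4AveragingDeficitWall.Plane (d + 1)) : ℝ)
              * (2 * (8 * α₀ * (2 * α₁ + 28 * α₀ ^ 2) + 6 * (Real.exp α₀ - 1) * (2 * α₁ + 24 * (Real.exp α₀ - 1) * α₀)
                  + (2 * α₁ + 24 * (Real.exp α₀ - 1) * α₀) * (2 * α₁ + 28 * α₀ ^ 2) + 960 * (Real.exp α₀ - 1) * α₀ ^ 2)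
                + 64 * α₀ * α₁))
        + Fintype.card n * ((2 * (CdecD d * (((d : ℝ) + 1) * (2 * ((d : ℝ) + 1))
              * ((2 + 32 / (kappa163 (d + 1) / (d + 1)) ^ 2) * latticeConst (d + 1) (kappa163 (d + 1) / (d + 1) / 2)))))
              / ((L ^ (k + 1) : ℕ) : ℝ)
            * ((0 + 28 * ((3 + 12 * ((d + 1 : ℕ) : ℝ)) * ((L : ℝ) ^ (k + 1) * α₀)
                    + 4 * (3 + 12 * ((d + 1 : ℕ) : ℝ)) ^ 3 / rho0 (d + 1) L ^ 2 * ((L : ℝ) ^ (k + 1) * α₀) ^ 2) ^ 2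
                  + 4 * (4 * (3 + 12 * ((d + 1 : ℕ) : ℝ)) ^ 3 / rho0 (d + 1) L ^ 2 * ((L : ℝ) ^ (k + 1) * α₀) ^ 2))
                / ((L ^ (k + 1) : ℕ) : ℝ)))
        + 28 * α₀ ^ 2) := by
  classical
  have hL1 : 1 ≤ L := by omega
  haveI : NeZero (L ^ (k + 1)) := ⟨pow_ne_zero _ (by omega)⟩
  have hP1 : 1 ≤ L ^ (k + 1) * N := Nat.one_le_iff_ne_zero.mpr (Nat.mul_ne_zero (pow_ne_zero _ (by omega)) (NeZero.ne N))
  have hmc : N * L ^ (k + 1) = L ^ (k + 1) * N := Nat.mul_comm _ _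
  have htowN : tower L N (k + 1) = L ^ (k + 1) * N := by rw [tower_eq, hmc]
  have htow : ((tower L N (k + 1) : ℕ) : ℤ) = ((L ^ (k + 1) * N : ℕ) : ℤ) := by rw [htowN]
  -- the flat reference and the representative
  have hflatU : IsUnitaryCfg (flat (d := d + 1) (n := n)) := (flat_mem_classes (d := d + 1) (n := n) le_rfl).1
  have hflat0 : SmallField (flat (d := d + 1) (n := n)) 0 := (flat_mem_classes (d := d + 1) (n := n) le_rfl).2
  have hflatx : SmallField (flat (d := d + 1) (n := n)) x := (flat_mem_classes (d := d + 1) (n := n) hx).2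
  have hflatP : IsPeriodicCfg (flat (d := d + 1) (n := n)) ((L ^ (k + 1) * N : ℕ) : ℤ) := fun _ _ _ => rfl
  have hUu : IsUnitaryCfg (vary (flat (d := d + 1) (n := n)) A 1) := vary_isUnitaryCfg hflatU hA 1
  have hUP : IsPeriodicCfg (vary (flat (d := d + 1) (n := n)) A 1) ((L ^ (k + 1) * N : ℕ) : ℤ) := vary_add_period hflatP hAP 1
  -- the coarse datum `φ = D_1 A`: `N`-periodic, with F43's curl bound `ĝ`
  have hs0 : LevelSmall (d + 1) L k 0 := levelSmall_zero L k
  have hAPt : IsPeriodicDir A ((tower L N (k + 1) : ℕ) : ℤ) := by rw [htow]; exact hAP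
  have hflatPt : IsPeriodicCfg (flat (d := d + 1) (n := n)) ((tower L N (k + 1) : ℕ) : ℤ) := fun _ _ _ => rfl
  obtain ⟨-, hφP⟩ := dirIter_skew_periodic (M := N) hL1 k hflatU hflatPt le_rfl hs0 hflat0 hA hAPt
  have hF0 : SmallField (cavgIter L (k + 1) (flat (d := d + 1) (n := n))) 0 := by rw [cavgIter_flat]; exact hflat0
  have hD : SmallField (cavgIter L (k + 1) (vary (flat (d := d + 1) (n := n)) A 1)) 0 := by rw [hflatTop]; exact hflat0
  have hgnn : 0 ≤ (0 + 28 * ((3 + 12 * ((d + 1 : ℕ) : ℝ)) * ((L : ℝ) ^ (k + 1) * α₀)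
        + 4 * (3 + 12 * ((d + 1 : ℕ) : ℝ)) ^ 3 / rho0 (d + 1) L ^ 2 * ((L : ℝ) ^ (k + 1) * α₀) ^ 2) ^ 2
      + 4 * (4 * (3 + 12 * ((d + 1 : ℕ) : ℝ)) ^ 3 / rho0 (d + 1) L ^ 2 * ((L : ℝ) ^ (k + 1) * α₀) ^ 2)) := by positivity
  have hĝ : ∀ (y : Site (d + 1)) (μ ν : Fin (d + 1)), ‖curlAt (flat (d := d + 1) (n := n)) (dirIter L (k + 1) (flat (d := d + 1) (n := n)) A) y μ ν‖
      ≤ 0 + 28 * ((3 + 12 * ((d + 1 : ℕ) : ℝ)) * ((L : ℝ) ^ (k + 1) * α₀)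
            + 4 * (3 + 12 * ((d + 1 : ℕ) : ℝ)) ^ 3 / rho0 (d + 1) L ^ 2 * ((L : ℝ) ^ (k + 1) * α₀) ^ 2) ^ 2
          + 4 * (4 * (3 + 12 * ((d + 1 : ℕ) : ℝ)) ^ 3 / rho0 (d + 1) L ^ 2 * ((L : ℝ) ^ (k + 1) * α₀) ^ 2) := by
    intro y μ ν
    by_cases hμν : μ = ν
    · subst hμν
      rw [curlAt_flat_eq, sub_self, norm_zero]
      exact hgnn
    · have h := coarseCurl_le hL k hflatU hflatP hflat0 hF0 hA hAP hα₀ hAα hσ hD y hμν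
      rwa [cavgIter_flat] at h
  -- the flat normal part `A_N = R_H B` (F36∕F37): EXACT + curl letter `c_N`; NORTH (F40b); periodic (F44)
  obtain ⟨hexact, hN7all⟩ := rightInverse_flat_curl_le (n := n) hL1 k N (dirIter L (k + 1) (flat (d := d + 1) (n := n)) A) hφP hĝ
  have hNexact := hexact
  rw [← dirIter_succ_eq_cpushIter L k] at hNexact
  have hNP := hkLift_periodic (d := d + 1) (n := n) hL1 k N
    (fun p : Tor (fun _ : Fin (d + 1) => N) × Fin (d + 1) => (((L ^ (k + 1) : ℕ) : ℂ))⁻¹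
      • dirIter L (k + 1) (flat (d := d + 1) (n := n)) A (B6LowerBound2153Torus.rep (fun _ : Fin (d + 1) => N) p.1) p.2)
  refine smallField_vary_of_flatLetters' hL1 k hflatU hflat0 hx hs hflatx hA hAP hAα hNP hNexact (fun z μ ν _ => hN7all z μ ν) ?_
    {X | IsPeriodicDir X ((L ^ (k + 1) * N : ℕ) : ℤ) ∧ dirIter L (k + 1) (flat (d := d + 1) (n := n)) X = 0} ?_
    (fun X _ hXP hXT g hg hsrc => hG X hXP hXT g hg hsrc) ?_ (fun Y hY hYP => abs_dAction_vary_sub_hess_flat_le hP1 hA hAP hα₀ hα₁ hAα hA1 hY hYP)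
    hcrit ?_ ?_
  · -- hNorth (F40b)
    intro Y hY hYP hYT
    rw [dirIter_succ_eq_cpushIter] at hYT
    exact hess_flat_hkLift_eq_zero hL1 k
      (fun p : Tor (fun _ : Fin (d + 1) => N) × Fin (d + 1) => (((L ^ (k + 1) : ℕ) : ℂ))⁻¹
        • dirIter L (k + 1) (flat (d := d + 1) (n := n)) A (B6LowerBound2153Torus.rep (fun _ : Fin (d + 1) => N) p.1) p.2) hY hYP hYT
  · -- the slice clause: `A − A_N` is periodic and tangent at `1`
    refine ⟨fun y i μ => by simp only [hAP y i μ, hNP y i μ], ?_⟩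
    rw [dirIter_sub hL1 k hflatU hx hs hflatx A _, hNexact]
    funext z κ
    simp
  · -- 0 ≤ ρ
    have hδ : 0 ≤ Real.exp α₀ - 1 := by linarith [Real.add_one_le_exp α₀]
    positivity
  · -- 0 ≤ τ
    have hpos : 0 < 1 - thetaLoc (d + 1) L * (((L : ℝ) ^ (k + 1)) ^ 2 * x) := by linarith
    have := curl1C_nonneg (d + 1) L
    positivity
  · -- hTT (F53, with the tower letter `Λ` as displayed)
    have hΛ' : ∀ Y : Site (d + 1) → Fin (d + 1) → Matrix n n ℂ, IsSkewDir Y → IsPeriodicDir Y ((N * L ^ (k + 1) : ℕ) : ℤ) →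
        ∑ z ∈ periodBox N, ∑ κ : Fin (d + 1), ‖QbarIter L (k + 1) (vary (flat (d := d + 1) (n := n)) A 1) Y z κ
            - QbarIter L (k + 1) (flat (d := d + 1) (n := n)) Y z κ‖ ≤ Λ * dirL1 Y (periodBox (d := d + 1) (N * L ^ (k + 1))) := by
      intro Y hY hYP
      rw [hmc] at hYP ⊢
      exact hΛ Y hY hYP
    have hUP' : IsPeriodicCfg (vary (flat (d := d + 1) (n := n)) A 1) ((N * L ^ (k + 1) : ℕ) : ℤ) := by rw [hmc]; exact hUP
    have hTT := hTT_gauge_of_towerLetter hL k hUu hUP' hx hs hUx hθ hθl hε ha hUa hflatTop hΛ'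
    intro Y hY hYP hYT
    have hYP' : IsPeriodicDir Y ((N * L ^ (k + 1) : ℕ) : ℤ) := by rw [hmc]; exact hYP
    obtain ⟨Y', hY's, hY'P, hY'T, hY'd⟩ := hTT Y hY hYP' hYT
    refine ⟨Y', hY's, by rw [← hmc]; exact hY'P, hY'T, ?_⟩
    rw [hmc] at hY'd
    exact hY'd


/-- **THE SAME, PULLED BACK THROUGH THE GAUGE TO THE ADMISSIBLE CONFIGURATION `U`** (`U^u = e^{A}` — REP♭'s gauge `u` unitary and
`(L^{k+1}·N)`-periodic; the class radius `x`, the plaquette radius `a` and tangent-criticality are asked of `U` and transported to the representative by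
`smallField_gaugeAct` and F39 `tanCritical_gaugeAct`; the conclusion comes back by F26 `smallField_of_gaugeAct_eq`). [folklore] -/
theorem smallField_of_trivialLetters_gauge [Nonempty n] {L N : ℕ} [NeZero N] (hL : 2 ≤ L) (k : ℕ)
    {U : Site (d + 1) → Fin (d + 1) → (Matrix n n ℂ)ˣ} (hU : IsUnitaryCfg U) {x a : ℝ} (hx : 0 ≤ x) (hs : LevelSmall (d + 1) L k x)
    (hUx : SmallField U x) (ha : 0 ≤ a) (hUa : SmallField U a)
    (hcritU : ∀ φ : Site (d + 1) → Fin (d + 1) → Matrix n n ℂ, IsSkewDir φ → IsPeriodicDir φ ((L ^ (k + 1) * N : ℕ) : ℤ) →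
      dirIter L (k + 1) U φ = 0 → dAction U φ (perWin (d + 1) (L ^ (k + 1) * N)) = 0)
    {u : Site (d + 1) → (Matrix n n ℂ)ˣ} (hu : IsUnitarySite u) (huP : ∀ (y : Site (d + 1)) (i : Fin (d + 1)), u (y + (((L ^ (k + 1) * N : ℕ) : ℤ)) • e i) = u y)
    {A : Site (d + 1) → Fin (d + 1) → Matrix n n ℂ} (hgauge : gaugeAct u U = vary (flat (d := d + 1) (n := n)) A 1)
    (hA : IsSkewDir A) (hAP : IsPeriodicDir A ((L ^ (k + 1) * N : ℕ) : ℤ))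
    {α₀ α₁ : ℝ} (hα₀ : 0 ≤ α₀) (hα₁ : 0 ≤ α₁) (hAα : ∀ (y : Site (d + 1)) (κ : Fin (d + 1)), ‖A y κ‖ ≤ α₀)
    (hA1 : ∀ (y : Site (d + 1)) (κ τ : Fin (d + 1)), ‖A (y + e τ) κ - A y κ‖ ≤ α₁)
    (hθ : cruxC (d + 1) L * (((L : ℝ) ^ (k + 1)) ^ 2 * x) < 1) (hθl : thetaLoc (d + 1) L * (((L : ℝ) ^ (k + 1)) ^ 2 * x) < 1)
    (hε : ((L : ℝ) ^ (k + 1)) ^ 2 * x ≤ 1)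
    (hσ : 4 * (3 + 12 * ((d + 1 : ℕ) : ℝ)) ^ 2 * (L : ℝ) ^ (k + 1) * α₀ ≤ rho0 (d + 1) L ^ 2)
    (hflatTop : cavgIter L (k + 1) (vary (flat (d := d + 1) (n := n)) A 1) = flat)
    {Λ : ℝ} (hΛ0 : 0 ≤ Λ)
    (hΛ : ∀ Y : Site (d + 1) → Fin (d + 1) → Matrix n n ℂ, IsSkewDir Y → IsPeriodicDir Y ((L ^ (k + 1) * N : ℕ) : ℤ) →
      ∑ z ∈ periodBox N, ∑ κ : Fin (d + 1), ‖QbarIter L (k + 1) (vary (flat (d := d + 1) (n := n)) A 1) Y z κ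
          - QbarIter L (k + 1) (flat (d := d + 1) (n := n)) Y z κ‖ ≤ Λ * dirL1 Y (periodBox (d := d + 1) (L ^ (k + 1) * N)))
    {KG : ℝ}
    (hG : ∀ X : Site (d + 1) → Fin (d + 1) → Matrix n n ℂ, IsPeriodicDir X ((L ^ (k + 1) * N : ℕ) : ℤ) →
      dirIter L (k + 1) (flat (d := d + 1) (n := n)) X = 0 → ∀ g : ℝ, 0 ≤ g →
      (∀ Y : Site (d + 1) → Fin (d + 1) → Matrix n n ℂ, IsSkewDir Y → IsPeriodicDir Y ((L ^ (k + 1) * N : ℕ) : ℤ) →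
        dirIter L (k + 1) (flat (d := d + 1) (n := n)) Y = 0 →
        |hess (flat (d := d + 1) (n := n)) X Y (perWin (d + 1) (L ^ (k + 1) * N))| ≤ g * dirL1 Y (periodBox (d := d + 1) (L ^ (k + 1) * N))) →
      ∀ (z : Site (d + 1)) (μ ν : Fin (d + 1)), μ ≠ ν → ‖curlAt (flat (d := d + 1) (n := n)) X z μ ν‖ ≤ KG * g) :
    SmallField U
      (KG * (((a * ((curl1C (d + 1) L / (1 - thetaLoc (d + 1) L * (((L : ℝ) ^ (k + 1)) ^ 2 * x)))
                  * (((L : ℝ) ^ (k + 1)) ^ (d + 1) / ((L : ℝ) ^ (k + 1)) ^ 2)))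
              * Λ)
            + (Fintype.card (T4AveragingDeficitWall.Plane (d + 1)) : ℝ)
              * (2 * (8 * α₀ * (2 * α₁ + 28 * α₀ ^ 2) + 6 * (Real.exp α₀ - 1) * (2 * α₁ + 24 * (Real.exp α₀ - 1) * α₀)
                  + (2 * α₁ + 24 * (Real.exp α₀ - 1) * α₀) * (2 * α₁ + 28 * α₀ ^ 2) + 960 * (Real.exp α₀ - 1) * α₀ ^ 2)
                + 64 * α₀ * α₁))
        + Fintype.card n * ((2 * (CdecD d * (((d : ℝ) + 1) * (2 * ((d : ℝ) + 1))
              * ((2 + 32 / (kappa163 (d + 1) / (d + 1)) ^ 2) * latticeConst (d + 1) (kappa163 (d + 1) / (d + 1) / 2)))))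
              / ((L ^ (k + 1) : ℕ) : ℝ)
            * ((0 + 28 * ((3 + 12 * ((d + 1 : ℕ) : ℝ)) * ((L : ℝ) ^ (k + 1) * α₀)
                    + 4 * (3 + 12 * ((d + 1 : ℕ) : ℝ)) ^ 3 / rho0 (d + 1) L ^ 2 * ((L : ℝ) ^ (k + 1) * α₀) ^ 2) ^ 2
                  + 4 * (4 * (3 + 12 * ((d + 1 : ℕ) : ℝ)) ^ 3 / rho0 (d + 1) L ^ 2 * ((L : ℝ) ^ (k + 1) * α₀) ^ 2))
                / ((L ^ (k + 1) : ℕ) : ℝ)))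
        + 28 * α₀ ^ 2) := by
  have hL1 : 1 ≤ L := by omega
  have hUx' : SmallField (vary (flat (d := d + 1) (n := n)) A 1) x := by rw [← hgauge]; exact smallField_gaugeAct hu hUx
  have hUa' : SmallField (vary (flat (d := d + 1) (n := n)) A 1) a := by rw [← hgauge]; exact smallField_gaugeAct hu hUa
  have hcrit := tanCritical_gaugeAct hL1 k hU hx hs hUx hu huP hcritU
  rw [hgauge] at hcrit
  exact smallField_of_gaugeAct_eq hu hgauge
    (smallField_vary_flat_of_trivialLetters hL k hA hAP hα₀ hα₁ hAα hA1 hx hs hUx' ha hUa' hθ hθl hε hσ hflatTop hΛ0 hΛ hcrit hG)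


/-- **THE CURRENCY OF `τ`** (memo H15 §7): with `M = L^{k+1}`, `(L∕L^{d'})^{k+1} = M∕M^{d'}`, so the transport density of the END,
`τ = (a·(C·(M^{d'}∕M²)))·(2·(C_S·α̂)·(L∕L^{d'})^{k+1})`, equals `2·a·C·C_S·α̂ ∕ M` — i.e. `2·C·C_S·δ·α̂·M⁻³` at the plaquette radius `a = δM⁻²`. [folklore] -/
theorem tau_currency {L : ℕ} (hL : 1 ≤ L) (k d' : ℕ) (a C CS αh : ℝ) :
    (a * (C * (((L : ℝ) ^ (k + 1)) ^ d' / ((L : ℝ) ^ (k + 1)) ^ 2))) * (2 * (CS * αh) * ((L : ℝ) / (L : ℝ) ^ d') ^ (k + 1))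
      = 2 * a * C * CS * αh / (L : ℝ) ^ (k + 1) := by
  have hM : (0 : ℝ) < (L : ℝ) ^ (k + 1) := pow_pos (by exact_mod_cast (show 0 < L by omega)) _
  rw [show ((L : ℝ) / (L : ℝ) ^ d') ^ (k + 1) = (L : ℝ) ^ (k + 1) / ((L : ℝ) ^ (k + 1)) ^ d' by
    rw [div_pow, ← pow_mul, ← pow_mul, mul_comm d' (k + 1)]]
  have hMd : (0 : ℝ) < ((L : ℝ) ^ (k + 1)) ^ d' := pow_pos hM _
  field_simp

/-- The same at the plaquette radius `a = δ∕M²`: `τ = 2·C·C_S·δ·α̂ ∕ M³`. [folklore] -/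
theorem tau_currency_delta {L : ℕ} (hL : 1 ≤ L) (k d' : ℕ) (δ C CS αh : ℝ) :
    (δ / ((L : ℝ) ^ (k + 1)) ^ 2 * (C * (((L : ℝ) ^ (k + 1)) ^ d' / ((L : ℝ) ^ (k + 1)) ^ 2))) * (2 * (CS * αh) * ((L : ℝ) / (L : ℝ) ^ d') ^ (k + 1))
      = 2 * C * CS * δ * αh / ((L : ℝ) ^ (k + 1)) ^ 3 := by
  rw [tau_currency hL k d' (δ / ((L : ℝ) ^ (k + 1)) ^ 2) C CS αh]
  have hM : (0 : ℝ) < (L : ℝ) ^ (k + 1) := pow_pos (by exact_mod_cast (show 0 < L by omega)) _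
  field_simp

end

end Summit.QuantumFields.BalabanUV.T4Continuum.NE7ApeTrivialFlatEnd
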